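import Mathlib
import Summits.Ventures.PercRepro.TriangleCapTwoTrianglesEightB

/-!
# PercRepro — TWO VERTEX-DISJOINT TRIANGLES PAY THE `r = 2` CELL FOR EVERY `k ≥ 8` (p3, gen 37; part 57)

`S = T₁ ∪ T₂` with `T₁`, `T₂` disjoint three-cliques such that every vertex off `Tᵢ` has at most one neighbour
in `Tᵢ` (the `K₄⁻`-free structure around two triangles).  Then `2 ≤ degIn S x ≤ 3` on `S`, so `12 ≤ Q ≤ 18`;
`degIn S z ≤ 2` off `S`, so `W(z) ≤ 3 degIn S z`; and the refined far count of TriangleCapTwoTrianglesEightB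
gives `Σ_p deficit(p) ≥ 84 − 4Q + |Sᶜ| (Q − 8) ≥ 4k` as soon as `|Sᶜ| ≥ 2` — tight on the prism at `k = 8`.
With at most `12` ordered triangles (`card_triangles3_le_twelve`: every triangle lies in `S`, and an edge lies in
at most one triangle), `2 Σ d² + Σ deficit = 2mk + |T₃|` gives `Σ_v d(v)² + 2 (k − 3) ≤ m k`:

* **`four_mul_card_le_sum_deficit_of_disjoint`** — the far count `4k ≤ Σ_p deficit(p)` for `k ≥ 8`;
* **`card_triangles3_le_twelve`** — at most twelve ordered triangles;
* **`two_triangles_stability_two_of_disjoint_eight`** — the two-triangle case of the `r = 2` stability for two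
  vertex-disjoint triangles and every `k ≥ 8` (gen 36 had `k ≥ 14`).
Axioms: standard.
-/

namespace PercRepro

namespace TriangleCap

namespace C047

open Finset

variable {V : Type*} [Fintype V] [DecidableEq V]

omit [Fintype V] in
/-- `degIn (A ∪ B) x ≤ degIn A x + degIn B x`. -/
theorem degIn_union_le (D : SimpleGraph V) [DecidableRel D.Adj] (A B : Finset V) (x : V) :
    degIn D (A ∪ B) x ≤ degIn D A x + degIn D B x := by
  unfold degIn
  rw [filter_union]
  exact card_union_le _ _

omit [Fintype V] in
/-- `degIn A x ≤ degIn (A ∪ B) x`. -/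
theorem degIn_left_le_union (D : SimpleGraph V) [DecidableRel D.Adj] (A B : Finset V) (x : V) :
    degIn D A x ≤ degIn D (A ∪ B) x := by
  unfold degIn
  apply card_le_card
  intro y hy
  rw [mem_filter] at hy ⊢
  exact ⟨mem_union_left _ hy.1, hy.2⟩

omit [Fintype V] in
/-- `degIn B x ≤ degIn (A ∪ B) x`. -/
theorem degIn_right_le_union (D : SimpleGraph V) [DecidableRel D.Adj] (A B : Finset V) (x : V) :
    degIn D B x ≤ degIn D (A ∪ B) x := by
  unfold degIn
  apply card_le_card
  intro y hy
  rw [mem_filter] at hy ⊢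
  exact ⟨mem_union_right _ hy.1, hy.2⟩

omit [Fintype V] in
/-- `degIn T x ≤ 2` for `x ∈ T`, `|T| = 3` (`x` is not its own neighbour). -/
theorem degIn_le_two_of_mem (D : SimpleGraph V) [DecidableRel D.Adj] {T : Finset V} (hT : T.card = 3) {x : V}
    (hx : x ∈ T) : degIn D T x ≤ 2 := by
  unfold degIn
  have : T.filter (fun y => D.Adj x y) ⊆ T.erase x := by
    intro y hy
    rw [mem_filter] at hy
    rw [mem_erase]
    exact ⟨hy.2.ne.symm, hy.1⟩
  have := card_le_card this
  rw [card_erase_of_mem hx, hT] at this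
  exact this

omit [Fintype V] [DecidableEq V] in
/-- `W(z) ≤ 3 degIn S z` when every vertex of `S` has at most three neighbours in `S`. -/
theorem sum_degIn_le_three_mul (D : SimpleGraph V) [DecidableRel D.Adj] (S : Finset V)
    (h3 : ∀ x ∈ S, degIn D S x ≤ 3) (z : V) :
    ∑ x ∈ S.filter (fun x => D.Adj z x), degIn D S x ≤ 3 * degIn D S z := by
  calc ∑ x ∈ S.filter (fun x => D.Adj z x), degIn D S x ≤ ∑ x ∈ S.filter (fun x => D.Adj z x), 3 :=
        sum_le_sum (fun x hx => h3 x (mem_filter.mp hx).1)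
    _ = 3 * degIn D S z := by rw [sum_const, smul_eq_mul, mul_comm]; rfl

/-- **THE FAR COUNT FOR TWO VERTEX-DISJOINT TRIANGLES:** `4k ≤ Σ_p deficit(p)` for `k ≥ 8`. -/
theorem four_mul_card_le_sum_deficit_of_disjoint (D : SimpleGraph V) [DecidableRel D.Adj] (T₁ T₂ : Finset V)
    (h₁ : T₁.card = 3) (h₂ : T₂.card = 3) (hdisj : Disjoint T₁ T₂)
    (hcl₁ : ∀ x ∈ T₁, ∀ y ∈ T₁, x ≠ y → D.Adj x y) (hcl₂ : ∀ x ∈ T₂, ∀ y ∈ T₂, x ≠ y → D.Adj x y)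
    (hone₁ : ∀ z, z ∉ T₁ → degIn D T₁ z ≤ 1) (hone₂ : ∀ z, z ∉ T₂ → degIn D T₂ z ≤ 1)
    (hk : 8 ≤ Fintype.card V) :
    4 * Fintype.card V ≤ ∑ p ∈ adjPairsAll D, deficit D p := by
  have hint : (T₁ ∩ T₂).card ≤ 1 := by
    rw [disjoint_iff_inter_eq_empty.mp hdisj, card_empty]
    exact Nat.zero_le _
  have hcount := two_triangles_far_count D T₁ T₂ h₁ h₂ hint hcl₁ hcl₂
  set S := T₁ ∪ T₂ with hS
  have hScard : S.card = 6 := by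
    rw [hS, card_union_of_disjoint hdisj, h₁, h₂]
  have hRcard : Sᶜ.card = Fintype.card V - 6 := by rw [card_compl, hScard]
  -- the degrees into `S`: between `2` and `3` on `S`, at most `2` off `S`
  have hdeg3 : ∀ x ∈ S, degIn D S x ≤ 3 := by
    intro x hx
    rw [hS] at hx ⊢
    rw [mem_union] at hx
    have h := degIn_union_le D T₁ T₂ x
    rcases hx with hx | hx
    · have hx2 : x ∉ T₂ := fun h' => disjoint_left.mp hdisj hx h'
      have := degIn_le_two_of_mem D h₁ hx
      have := hone₂ x hx2
      omega
    · have hx1 : x ∉ T₁ := fun h' => disjoint_left.mp hdisj h' hx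
      have := degIn_le_two_of_mem D h₂ hx
      have := hone₁ x hx1
      omega
  have hdeg2 : ∀ x ∈ S, 2 ≤ degIn D S x := by
    intro x hx
    rw [hS] at hx ⊢
    rw [mem_union] at hx
    rcases hx with hx | hx
    · have := degIn_left_le_union D T₁ T₂ x
      rw [degIn_self_of_clique D h₁ hcl₁ hx] at this
      exact this
    · have := degIn_right_le_union D T₁ T₂ x
      rw [degIn_self_of_clique D h₂ hcl₂ hx] at this
      exact this
  have hout : ∀ z ∈ Sᶜ, degIn D S z ≤ 2 := by
    intro z hz
    rw [mem_compl, hS, mem_union, not_or] at hz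
    rw [hS]
    have h := degIn_union_le D T₁ T₂ z
    have := hone₁ z hz.1
    have := hone₂ z hz.2
    omega
  -- `12 ≤ Q ≤ 18` and `Σ_{T₁} + Σ_{T₂} = Q`
  have hQ : adjPairs D S = ∑ x ∈ T₁, degIn D S x + ∑ x ∈ T₂, degIn D S x := by
    rw [adjPairs_eq_sum_degIn, hS, sum_union hdisj]
  have hQle : adjPairs D S ≤ 18 := by
    rw [adjPairs_eq_sum_degIn]
    calc ∑ x ∈ S, degIn D S x ≤ ∑ _x ∈ S, 3 := sum_le_sum hdeg3
      _ = 18 := by rw [sum_const, hScard, smul_eq_mul]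
  have hQge : 12 ≤ adjPairs D S := by
    rw [adjPairs_eq_sum_degIn]
    calc 12 = ∑ _x ∈ S, 2 := by rw [sum_const, hScard, smul_eq_mul]
      _ ≤ ∑ x ∈ S, degIn D S x := sum_le_sum hdeg2
  -- the outside sums
  have hW : ∑ z ∈ Sᶜ, ∑ x ∈ S.filter (fun x => D.Adj z x), degIn D S x ≤ 3 * ∑ z ∈ Sᶜ, degIn D S z := by
    rw [mul_sum]
    exact sum_le_sum (fun z _ => sum_degIn_le_three_mul D S hdeg3 z)
  have hsq : ∑ z ∈ Sᶜ, degIn D S z * degIn D S z ≤ 2 * ∑ z ∈ Sᶜ, degIn D S z := by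
    rw [mul_sum]
    apply sum_le_sum
    intro z hz
    have := hout z hz
    nlinarith
  have hsd : ∑ z ∈ Sᶜ, degIn D S z * degIn D Sᶜ z ≤ 2 * ∑ z ∈ Sᶜ, degIn D Sᶜ z := by
    rw [mul_sum]
    apply sum_le_sum
    intro z hz
    have := hout z hz
    nlinarith
  have hs : ∑ z ∈ Sᶜ, degIn D S z ≤ 2 * Sᶜ.card := by
    calc ∑ z ∈ Sᶜ, degIn D S z ≤ ∑ _z ∈ Sᶜ, 2 := sum_le_sum hout
      _ = 2 * Sᶜ.card := by rw [sum_const, smul_eq_mul, mul_comm]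
  -- assemble: `Σ deficit ≥ 84 − 4Q + |Sᶜ| (Q − 8)`, then the cases `|Sᶜ| ≤ 3` / `|Sᶜ| ≥ 4`
  rw [hScard] at hcount
  set Q := adjPairs D S with hQdef
  set R := Sᶜ.card with hRdef
  set s := ∑ z ∈ Sᶜ, degIn D S z with hsdef
  set d := ∑ z ∈ Sᶜ, degIn D Sᶜ z with hddef
  set W := ∑ z ∈ Sᶜ, ∑ x ∈ S.filter (fun x => D.Adj z x), degIn D S x with hWdef
  set sq := ∑ z ∈ Sᶜ, degIn D S z * degIn D S z with hsqdef
  set sd := ∑ z ∈ Sᶜ, degIn D S z * degIn D Sᶜ z with hsddef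
  set Def := ∑ p ∈ adjPairsAll D, deficit D p with hDef
  clear_value Q R s d W sq sd Def
  have hk' : Fintype.card V = R + 6 := by omega
  rw [hk']
  have hmain : R * Q + 84 ≤ Def + 4 * Q + 8 * R := by linarith
  have hR2 : 2 ≤ R := by omega
  rcases Nat.lt_or_ge R 4 with hR | hR
  · interval_cases R <;> omega
  · obtain ⟨r, hr⟩ : ∃ r, R = r + 4 := ⟨R - 4, by omega⟩
    subst hr
    have : 12 * r ≤ r * Q := by nlinarith
    nlinarith

/-- **AT MOST TWELVE ORDERED TRIANGLES** when every triangle lies in `S = T₁ ∪ T₂`, every vertex off `Tᵢ` has at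
most one neighbour in `Tᵢ`, and an edge lies in at most one triangle. -/
theorem card_triangles3_le_twelve (D : SimpleGraph V) [DecidableRel D.Adj] (T₁ T₂ : Finset V)
    (h₁ : T₁.card = 3) (h₂ : T₂.card = 3) (hdisj : Disjoint T₁ T₂)
    (hcl₁ : ∀ x ∈ T₁, ∀ y ∈ T₁, x ≠ y → D.Adj x y) (hcl₂ : ∀ x ∈ T₂, ∀ y ∈ T₂, x ≠ y → D.Adj x y)
    (hone₁ : ∀ z, z ∉ T₁ → degIn D T₁ z ≤ 1) (hone₂ : ∀ z, z ∉ T₂ → degIn D T₂ z ≤ 1)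
    (hT : ∀ x y z, D.Adj x y → D.Adj x z → D.Adj y z → x ∈ T₁ ∪ T₂)
    (hcodeg : ∀ x y z z', D.Adj x y → D.Adj x z → D.Adj y z → D.Adj x z' → D.Adj y z' → z = z') :
    (triangles3 D).card ≤ 12 := by
  -- two neighbours in `T` of a vertex off `T` coincide
  have hone : ∀ (T : Finset V), (∀ z, z ∉ T → degIn D T z ≤ 1) → ∀ z, z ∉ T → ∀ p ∈ T, ∀ q ∈ T,
      D.Adj z p → D.Adj z q → p = q := by
    intro T hT z hz p hp q hq hzp hzq
    have h := hT z hz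
    unfold degIn at h
    exact card_le_one.mp h p (mem_filter.mpr ⟨hp, hzp⟩) q (mem_filter.mpr ⟨hq, hzq⟩)
  have hP₁ : ((T₁ ×ˢ T₁).filter (fun p : V × V => D.Adj p.1 p.2)).card = 6 := by
    have := adjPairs_eq_sum_degIn D T₁
    unfold adjPairs at this
    rw [this, sum_congr rfl (fun x hx => degIn_self_of_clique D h₁ hcl₁ hx), sum_const, h₁, smul_eq_mul]
  have hP₂ : ((T₂ ×ˢ T₂).filter (fun p : V × V => D.Adj p.1 p.2)).card = 6 := by
    have := adjPairs_eq_sum_degIn D T₂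
    unfold adjPairs at this
    rw [this, sum_congr rfl (fun x hx => degIn_self_of_clique D h₂ hcl₂ hx), sum_const, h₂, smul_eq_mul]
  set U : Finset (V × V) := (T₁ ×ˢ T₁).filter (fun p : V × V => D.Adj p.1 p.2) ∪
    (T₂ ×ˢ T₂).filter (fun p : V × V => D.Adj p.1 p.2) with hU
  clear_value U
  have hmaps : Set.MapsTo (fun t : (V × V) × V => t.1) (triangles3 D : Set ((V × V) × V))
      (U : Set (V × V)) := by
    intro t ht
    rw [mem_coe, triangles3, mem_filter, mem_product, mem_adjPairsAll] at ht
    obtain ⟨⟨hxy, -⟩, hxz, hyz⟩ := ht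
    rw [mem_coe, hU, mem_union, mem_filter, mem_filter, mem_product, mem_product]
    have hx := hT t.1.1 t.1.2 t.2 hxy hxz hyz
    have hy := hT t.1.2 t.1.1 t.2 hxy.symm hyz hxz
    have hz := hT t.2 t.1.1 t.1.2 hxz.symm hyz.symm hxy
    rw [mem_union] at hx hy hz
    rcases hx with hx | hx <;> rcases hy with hy | hy
    · exact Or.inl ⟨⟨hx, hy⟩, hxy⟩
    · -- `x ∈ T₁`, `y ∈ T₂`: the apex `z` would give two neighbours in one triangle
      exfalso
      rcases hz with hz | hz
      · have hy1 : t.1.2 ∉ T₁ := fun h => disjoint_left.mp hdisj h hy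
        have := hone T₁ hone₁ t.1.2 hy1 t.1.1 hx t.2 hz hxy.symm hyz
        exact hxz.ne this
      · have hx2 : t.1.1 ∉ T₂ := fun h => disjoint_left.mp hdisj hx h
        have := hone T₂ hone₂ t.1.1 hx2 t.1.2 hy t.2 hz hxy hxz
        exact hyz.ne this
    · -- `x ∈ T₂`, `y ∈ T₁`
      exfalso
      rcases hz with hz | hz
      · have hx1 : t.1.1 ∉ T₁ := fun h => disjoint_left.mp hdisj h hx
        have := hone T₁ hone₁ t.1.1 hx1 t.1.2 hy t.2 hz hxy hxz
        exact hyz.ne this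
      · have hy2 : t.1.2 ∉ T₂ := fun h => disjoint_left.mp hdisj hy h
        have := hone T₂ hone₂ t.1.2 hy2 t.1.1 hx t.2 hz hxy.symm hyz
        exact hxz.ne this
    · exact Or.inr ⟨⟨hx, hy⟩, hxy⟩
  have hinj : Set.InjOn (fun t : (V × V) × V => t.1) (triangles3 D) := by
    intro t ht t' ht' h
    simp only at h
    rw [mem_coe, triangles3, mem_filter, mem_product, mem_adjPairsAll] at ht ht'
    obtain ⟨⟨hxy, -⟩, hxz, hyz⟩ := ht
    obtain ⟨⟨-, -⟩, hxz', hyz'⟩ := ht'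
    rw [← h] at hxz' hyz'
    have := hcodeg t.1.1 t.1.2 t.2 t'.2 hxy hxz hyz hxz' hyz'
    exact Prod.ext h this
  have := card_le_card_of_injOn _ hmaps hinj
  have hu := card_union_le ((T₁ ×ˢ T₁).filter (fun p : V × V => D.Adj p.1 p.2))
    ((T₂ ×ˢ T₂).filter (fun p : V × V => D.Adj p.1 p.2))
  rw [← hU] at hu
  omega

omit [Fintype V] in
/-- `|{u, v, w}| = 3` for distinct `u, v, w`. -/
theorem card_triple {u v w : V} (huv : u ≠ v) (huw : u ≠ w) (hvw : v ≠ w) :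
    ({u, v, w} : Finset V).card = 3 := by
  rw [card_insert_of_notMem, card_pair hvw]
  simp only [mem_insert, mem_singleton, not_or]
  exact ⟨huv, huw⟩

omit [Fintype V] in
/-- A triangle is a clique. -/
theorem clique_triple (D : SimpleGraph V) [DecidableRel D.Adj] {u v w : V} (huv : D.Adj u v) (huw : D.Adj u w)
    (hvw : D.Adj v w) : ∀ x ∈ ({u, v, w} : Finset V), ∀ y ∈ ({u, v, w} : Finset V), x ≠ y → D.Adj x y := by
  intro x hx y hy hxy
  simp only [mem_insert, mem_singleton] at hx hy
  rcases hx with rfl | rfl | rfl <;> rcases hy with rfl | rfl | rfl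
  all_goals first
    | exact (hxy rfl).elim
    | exact huv
    | exact huw
    | exact hvw
    | exact huv.symm
    | exact huw.symm
    | exact hvw.symm

/-- A vertex off a triangle of a `K₄⁻`-free graph has at most one neighbour in it. -/
theorem degIn_le_one_of_triangle (D : SimpleGraph V) [DecidableRel D.Adj] (hK : K4mFree D) {u v w : V}
    (huv : D.Adj u v) (huw : D.Adj u w) (hvw : D.Adj v w) {z : V} (hz : z ∉ ({u, v, w} : Finset V)) :
    degIn D {u, v, w} z ≤ 1 := by
  have hz' : ¬ (z = u ∨ z = v ∨ z = w) := by simpa only [mem_insert, mem_singleton] using hz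
  obtain ⟨h1, h2, h3⟩ := at_most_one_of_triangle D hK huv huw hvw hz'
  unfold degIn
  apply card_le_one.mpr
  intro p hp q hq
  rw [mem_filter] at hp hq
  simp only [mem_insert, mem_singleton] at hp hq
  obtain ⟨hp1, hp2⟩ := hp
  obtain ⟨hq1, hq2⟩ := hq
  rcases hp1 with rfl | rfl | rfl <;> rcases hq1 with rfl | rfl | rfl
  all_goals first
    | rfl
    | exact (h1 ⟨hp2.symm, hq2.symm⟩).elim
    | exact (h1 ⟨hq2.symm, hp2.symm⟩).elim
    | exact (h2 ⟨hp2.symm, hq2.symm⟩).elim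
    | exact (h2 ⟨hq2.symm, hp2.symm⟩).elim
    | exact (h3 ⟨hp2.symm, hq2.symm⟩).elim
    | exact (h3 ⟨hq2.symm, hp2.symm⟩).elim

/-- In a `K₄⁻`-free graph an edge lies in at most one triangle. -/
theorem eq_of_common_nbr (D : SimpleGraph V) [DecidableRel D.Adj] (hK : K4mFree D) {x y z z' : V}
    (hxy : D.Adj x y) (hxz : D.Adj x z) (hyz : D.Adj y z) (hxz' : D.Adj x z') (hyz' : D.Adj y z') : z = z' := by
  by_contra hne
  have hz' : ¬ (z' = x ∨ z' = y ∨ z' = z) := by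
    rintro (h | h | h)
    · exact hxz'.ne h.symm
    · exact hyz'.ne h.symm
    · exact hne h.symm
  exact (at_most_one_of_triangle D hK hxy hxz hyz hz').1 ⟨hxz', hyz'⟩

/-- **THE TWO-TRIANGLE CASE OF THE `r = 2` STABILITY FOR VERTEX-DISJOINT TRIANGLES AND EVERY `k ≥ 8`:** `K₄⁻`-free,
two triangles `u v w`, `a b c` without a common vertex, every triangle on `{u, v, w, a, b, c}` ⇒
`Σ_v d(v)² + 2 (k − 3) ≤ m k`. -/
theorem two_triangles_stability_two_of_disjoint_eight (D : SimpleGraph V) [DecidableRel D.Adj] (hK : K4mFree D)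
    (hk : 8 ≤ Fintype.card V) {u v w a b c : V}
    (huv : D.Adj u v) (huw : D.Adj u w) (hvw : D.Adj v w) (hab : D.Adj a b) (hac : D.Adj a c) (hbc : D.Adj b c)
    (hT3 : ∀ x y z, D.Adj x y → D.Adj x z → D.Adj y z → x = u ∨ x = v ∨ x = w ∨ x = a ∨ x = b ∨ x = c)
    (hdisj : ∀ t, (t = u ∨ t = v ∨ t = w) → ¬ (t = a ∨ t = b ∨ t = c)) :
    ∑ v, deg D v * deg D v + 2 * (Fintype.card V - 3) ≤ D.edgeFinset.card * Fintype.card V := by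
  set T₁ : Finset V := {u, v, w} with hT₁
  set T₂ : Finset V := {a, b, c} with hT₂
  have h₁ : T₁.card = 3 := card_triple huv.ne huw.ne hvw.ne
  have h₂ : T₂.card = 3 := card_triple hab.ne hac.ne hbc.ne
  have hd : Disjoint T₁ T₂ := by
    rw [disjoint_left]
    intro t ht1 ht2
    rw [hT₁] at ht1
    rw [hT₂] at ht2
    simp only [mem_insert, mem_singleton] at ht1 ht2
    exact hdisj t ht1 ht2
  have hcl₁ := clique_triple D huv huw hvw
  have hcl₂ := clique_triple D hab hac hbc
  have hone₁ : ∀ z, z ∉ T₁ → degIn D T₁ z ≤ 1 := fun z hz => degIn_le_one_of_triangle D hK huv huw hvw hz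
  have hone₂ : ∀ z, z ∉ T₂ → degIn D T₂ z ≤ 1 := fun z hz => degIn_le_one_of_triangle D hK hab hac hbc hz
  have hT : ∀ x y z, D.Adj x y → D.Adj x z → D.Adj y z → x ∈ T₁ ∪ T₂ := by
    intro x y z hxy hxz hyz
    rw [hT₁, hT₂, mem_union]
    simp only [mem_insert, mem_singleton]
    rcases hT3 x y z hxy hxz hyz with h | h | h | h | h | h
    · exact Or.inl (Or.inl h)
    · exact Or.inl (Or.inr (Or.inl h))
    · exact Or.inl (Or.inr (Or.inr h))
    · exact Or.inr (Or.inl h)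
    · exact Or.inr (Or.inr (Or.inl h))
    · exact Or.inr (Or.inr (Or.inr h))
  have hdef := four_mul_card_le_sum_deficit_of_disjoint D T₁ T₂ h₁ h₂ hd hcl₁ hcl₂ hone₁ hone₂ hk
  have h12 := card_triangles3_le_twelve D T₁ T₂ h₁ h₂ hd hcl₁ hcl₂ hone₁ hone₂ hT
    (fun x y z z' hxy hxz hyz hxz' hyz' => eq_of_common_nbr D hK hxy hxz hyz hxz' hyz')
  have hid := two_mul_sum_deg_sq_add_sum_deficit D
  have hmk : 2 * (D.edgeFinset.card * Fintype.card V) = 2 * D.edgeFinset.card * Fintype.card V := by ring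
  omega

end C047

end TriangleCap

end PercRepro
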